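import Literature.AlgebraicGeometry.ModuliOfAbelianVarieties.SiegelFineModuliArtinianLifting
import Literature.AlgebraicGeometry.ModuliOfAbelianVarieties.SiegelFineModuliArtinianLiftingPolarized
import Literature.AlgebraicGeometry.AbelianSchemes.PolarizedLiftOfLineBundleLift
import Literature.AlgebraicGeometry.Morphisms.ProjectiveMorphism
import Literature.AlgebraicGeometry.AbelianSchemes.ProjectiveOfLiftOfPolarizedFibre
import Literature.AlgebraicGeometry.ModuliOfAbelianVarieties.SiegelFineModuliArtinianLiftingPolarizedPrincipal -- (ED. 3P) ★ p795680 (A2♯) junction-P `smooth_of_forall_principalSmallExtension_exists_polarizedLift`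
import Summits.HodgeConjecture.HodgeConjecture.Theorems.F3DualAbelianSchemeStubF3 -- (ED. 4) ★ p797885 T4: α2′ closer `F11SmoothRoadA.stub_dualPairOfLift_holds` (F0P1c-p06 (g2); F-3 head `stub_F3_holds` over (Z)(K)(M)(L))
import Summits.HodgeConjecture.HodgeConjecture.Theorems.F11SmoothRoadAStubF11 -- (ED. 5) α1-P closer `F11SmoothRoadA.stub_liftWithLineBundle_holds` (B-p05 (g20) over MONO-G1 `F11StubG1AbelianLift.stubG1_holds` ⊕ MONO-G2 `F11StubG2LineBundleLift.stubG2_holds`; also carries `stub_F11_holds`)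
import HarnessLib

/-!
# FLOOR-0 programme P1, sub-line F-11 «`𝒜_{g,δ,N} → Spec ℚ` is SMOOTH» — ROAD A (Artinian lifting) skeleton, **ED. 2 DRAFT (cut α)** over v0-REG2 9513a5b0: `stub_polarizedLift` PROVED from the two residual stubs α1 `stub_liftWithLineBundle` + α2 `stub_dualPairOfLift` via ★-in-HOME (7) `exists_polarizedLift_of_lineBundle_lift` (B-p05 (g19); pen B-plan1 (g19) 20:30:47Z)
# (`F0/P1/Lines/F11SmoothRoadA.lean`; director s317/s320: author B-plan1 (g19); THIS FILE = B-p05 (g19)'s DRAFT INPUT, not a registration)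

HC_CM is proved only modulo the 7 printed citations until rung 0 closes.  Count-neutral: this line discharges the
registered letter `stub_F11` of the crux registry `Cruxes/HDel/Lines/F1ExtHodgeType.lean` (v5.5-C) / the `hF11` binder of ★
`SiegelFineModuliSchemeOfCores.exists_threshold_siegelFineModuliScheme_of_cores` (:136–137), BYTE-IDENTICAL letter (B-p13 (g20)
`stub_F11.letter` 93d7802c).

THE LINE (one registered stub; composition kernel-checked):

  `F11_of_polarizedLift : (stub_polarizedLift) → stub_F11-letter`
    := ★-in-HOME (A2) `SiegelFineModuliScheme.smooth_of_forall_smallExtension_ne_top_exists_polarizedLift`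
       (B-p05 (g19) rf v3 eae6db501ca1a7e8, GREEN by paste over ED. 2 218359069d8935f4 of ★ p769385; lands after ED. 2),
  i.e. EGA IV 17.14.2 through «fine moduli» (★ p769385 (A1)+(A6), letter repaired to GENUINE small extensions `J ≠ ⊤` by ED. 2) +
  «a lift of the LEVEL-FREE polarised abelian scheme is a lift of the triple» ((A2): level structure by [SGA1] I 5.6 ★, type /
  symplectic liftability by the ★ relation-form transfers, second normalisation by ★ `DualPair.normalize`).

THE ONE STUB — `stub_polarizedLift` («polarised abelian schemes, with their dual pair, lift along genuine small extensions of
Artinian local ℚ-algebras», [Lan2013PELCompactifications] §2.2.1–2.2.4 (Prop. 2.2.2.3, Cor. 2.2.4.12–2.2.4.14); [Oort1971] §2;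
[MumfordFogartyKirwan1994] App. 7A p. 235 «Grothendieck»): for `A` Artinian local over `ℚ`, `J ≠ ⊤`, `𝔪_A J = 0`, and over
`Spec (A ⧸ J)` an abelian scheme `A₀` of relative dimension `g` with dual pair `(Â₀, 𝒫₀)` (normalised on both slices) and a
polarisation `λ₀`: there are over `Spec A` an abelian scheme `X` of relative dimension `g`, a dual pair `(X̂, 𝒫)`, a polarisation
`λ`, and `G : X₀ → X`, `Ĝ : X̂₀ → X̂` over `Spec (A⧸J) → Spec A` — base-change squares of group schemes — with `(G × Ĝ)^*𝒫 ≅ 𝒫₀`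
and `λ₀ ≫ Ĝ = G ≫ λ`.  NO level structure, NO type, NO normalisation is asked of the lift.  Its own sub-line (the line CARD
`F11SmoothRoadA.md` §3; census `typers/CENSUS-F11-Smoothness.B-typ02g16.md` 495c4307 §§3, 8–10): (A3) obstruction theory of
smooth schemes along small extensions (★ p769162 + HOME F1/F2), (A4a) abelian schemes are unobstructed ⟸ (iv) «no `c ∈ H²(X_s, 𝒪)`
with `[n]^*c = n·c ∀ n`, char 0» ⟸ (K½) Künneth injectivity (★ p781463 + HOME F0/F4), (A4b) a flat lift with a section is an abelian
scheme ([MFK94] Prop. 6.15; ★ p774879, ★ `kunneth_cechH1_slices_injective`, HOME LACK-3), (A5) among the lifts of `A₀` (a torsor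
under `H¹(X_s, 𝒯) ⊗ J`) some carries `λ₀` and the dual pair — the F-3 ARTIN SLICE (dual abelian scheme over an Artin local
ℚ-algebra: P1 sub-line `F3DualAbelianScheme`, now IN SCOPE, D-0183) + KS-symmetry / cup-product surjectivity in characteristic 0.

Why ONE stub and not (A4) ∧ (A5) as two: (A5) is not «every lift carries `λ₀`» (false — only a sub-torsor does) but «SOME lift
does», so it ranges over the lifts (A4) produces; the honest first cut below the ★ junctions is the joint statement.  The head
instantiates it at `(P₀.A, P₀.relDim, P₀.D, P₀.hatNormalised, P₀.pol)`.

`sorry` census of THIS VARIANT: TWO (`stub_junctionA2` — bytes GREEN in HOME —, `stub_polarizedLift`).  `#print axioms stub_F11` = trio + `sorryAx`.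
-/

/-!
ED. 2‴ (this draft = ED. 2′ with αP CLOSED BY NAME over ★ p792245 AND `stub_junctionA2` CLOSED BY NAME over ★ (A2) p794350; B-plan1 (g19) 20:30:47Z «F-11 LINE ED. 2 v0» + B-typ02 (g17) 20:36:44Z projectivity finding): `sorry` census =
{`stub_liftWithLineBundle` (α1: the PAIR `(A₀, L^Δ(λ₀))` lifts — the F-3-free
deformation-theoretic heart), `stub_dualPairOfLift` (α2 = the F-3 head
at `S = Spec A`, WITH its `IsProjective` binder)}; `stub_polarizedLift` is now a THEOREM over α1 + α2 + ★-in-HOME (7)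
`AbelianSchemes/PolarizedLiftOfLineBundleLift` 5af0d3cc (α2-glue ⊕ α3: dual transport ★ `hatTransportOfBaseChange` + `Λ(L) = [2] ≫ λ`),
which itself rests on (3) `HomKillsTorsionOfThickening` 072dea08, (5) `MumfordLambdaOfBaseChangeSquare` e68660f8, (6)
`PolarizationOfLineBundleLift` 5f624cd6 — all GREEN in HOME `B-provers/B-p05/g19/F11/`, in the lane-P FIFO (U132).  This file
elaborates BY PASTE tonight; it becomes registrable (tree-only imports) the minute (3)(5)(6)(7) are ★.
-/

/-!
ED. 3P «PRINCIPAL LETTERS» (F0P1b-plan (g0) (R84) 2026-08-31T00:10Z; bytes F0P1a-p01 (g2) (free F0 hand); parent pen B-p05 (g19) FIT∕consent;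
referee F0P1b-ref1; registrar B-plan1 (g20), NO `skeleton check`).  WHY: the G1∕G2 integrators' heads are the PRINCIPAL letters (MONO-G1
`G1P_of_sockets`, MONO-G2), which compose to α1-P = the head `stub_liftWithLineBundle_holds` of the grandchild line `Lines/F11LiftWithLineBundle.lean`
v0.2P — a small extension `A ↠ A⧸(t)` with `t ≠ 0`, `t ∈ 𝔪_A`, `𝔪_A·(t) = 0` (every small extension of Artinian local rings factors through
principal ones; [Schlessinger1968] (1.2)–(1.3)) — not to the general-`J` α1 of ED. 2‴.  WHAT CHANGES vs tree ED. 2‴ 80420199: (1) α1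
`stub_liftWithLineBundle` := the α1-P LETTER VERBATIM (`F0/P1b/Lines/LETTERS-alpha1P-G1P-G2P.v0.2P` e16e5f66 :5–16; `J` ↦ `Ideal.span {t}`
with the principal binders `(t : A), t ≠ 0 → t ∈ maximalIdeal A → maximalIdeal A * Ideal.span {t} = ⊥ →`); (2) α2′ `stub_dualPairOfLift`
UNCHANGED (its `…_holds` name stays reserved for P1c's T4 rider); (3) `stub_polarizedLift` (a THEOREM, not a letter) re-stated at
`J := Ideal.span {t}` with the same binders and RE-PROVED by the ED. 2‴ body token for token over α1-P + αP `stub_projectiveOfLift` (general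
`J`, fed `Ideal.span {t}` and the derived `(t) ≠ ⊤`) + α2′ + ★ (7) `exists_polarizedLift_of_lineBundle_lift`; (4) `stub_F11` (statement
BYTE-IDENTICAL = the registry letter) := ★ (A2♯) `SiegelFineModuliScheme.smooth_of_forall_principalSmallExtension_exists_polarizedLift`
(p795680 `ModuliOfAbelianVarieties/SiegelFineModuliArtinianLiftingPolarizedPrincipal`: EGA IV 17.14.2 needs lifting along PRINCIPAL small
extensions only; its `H` carries an extra `[Module.Finite ℚ (ResidueField A)]` binder that `stub_polarizedLift` does not use) instead of the
general-`J` junction `stub_junctionA2` (★ (A2) p794350), which stays in the file as an UNUSED theorem (B-p05 (g19) may delete it in a later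
edition); (5) this paragraph + ONE import.  `stub_projectiveOfLift`, the two private helpers and every docstring outside the touched decls are
byte-identical.  `sorry` census = {α1-P `stub_liftWithLineBundle`, α2′ `stub_dualPairOfLift`} (2, as before); `#print axioms stub_F11` = trio ⊕
`sorryAx` (via those two only).  HC_CM is proved only modulo the 7 printed citations until rung 0 closes.
-/

/-!
ED. 4 «α2′ BY NAME» (F0P1b-plan (g0) (R107) 2026-08-31T00:29Z; bytes F0P1a-p01 (g2); parent pen B-p05 (g19); referee F0P1b-ref1; registrar B-plan1 (g20),
NO `skeleton check`): = ED. 3P v2 0669747d with ONE import (★ p797885 `Summits/HodgeConjecture/HodgeConjecture/Theorems/F3DualAbelianSchemeStubF3`,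
F0P1c-p06 (g2) T4: the F-3 line's head `F3DualAbelianScheme.stub_F3_holds` — [MumfordFogartyKirwan1994] Cor. 6.8 Zariski-locally over the ★ (Z)(K)(M)
closers + (L) — and its F-11 rider `F11SmoothRoadA.stub_dualPairOfLift_holds`, the FQN reserved by (R36)) and α2′ `stub_dualPairOfLift` (statement
BYTE-IDENTICAL) PROVED BY NAME `:= stub_dualPairOfLift_holds g`.  Everything else byte-identical.  `sorry` census 2 → 1 = {α1-P `stub_liftWithLineBundle`}
= MONO-G1 ⊕ MONO-G2 of the grandchild `Lines/F11LiftWithLineBundle.lean` v0.2P; `#print axioms stub_F11` = trio ⊕ `sorryAx` via α1-P ALONE.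
HC_CM is proved only modulo the 7 printed citations until rung 0 closes.
-/

/-!
ED. 5 «α1-P BY NAME — THE LINE IS SORRY-FREE» (F0P1b-plan (g2) (R124) 2026-08-31T00:57Z; bytes F0P1a-p01 (g2); parent pen B-p05; referee F0P1b-ref1;
registrar B-plan1 (g20), NO `skeleton check`): = ED. 4 bf1a9381 with ONE import (`Summits/HodgeConjecture/HodgeConjecture/Theorems/F11SmoothRoadAStubF11`,
B-p05 (g20): the α1-P rider `F11SmoothRoadA.stub_liftWithLineBundle_holds` = G0 ★ `F11StubG0CoefficientField.stubG0_holds` (coefficient field) ▸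
MONO-G1 `F11StubG1AbelianLift.stubG1_holds` (some abelian lift along the principal small extension) ▸ MONO-G2 `F11StubG2LineBundleLift.stubG2_holds`
(move the lift until it carries `L^Δ(λ₀)`), i.e. the grandchild line `Lines/F11LiftWithLineBundle.lean` closed; the same file carries `stub_F11_holds`,
the name the registry folds `stub_F11` by) and α1-P `stub_liftWithLineBundle` (statement BYTE-IDENTICAL, declsig d9e8accf) PROVED BY NAME
`:= stub_liftWithLineBundle_holds g`.  Everything else byte-identical.  `sorry` census 1 → 0: THIS LINE IS SORRY-FREE; `#print axioms stub_F11` =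
{propext, Classical.choice, Quot.sound}.  HC_CM is proved only modulo the 7 printed citations until rung 0 closes.
-/

noncomputable section

open CategoryTheory CategoryTheory.Limits AlgebraicGeometry IsLocalRing
open Literature.AlgebraicGeometry.AbelianSchemes Literature.AlgebraicGeometry.ModuliOfAbelianVarieties
  Literature.AlgebraicGeometry.Modules Literature.AlgebraicGeometry.Motives
open Literature.AlgebraicGeometry.Morphisms (IsProjective)

namespace Summit.HodgeConjecture.CorCM.Cruxes.HypDel.F11SmoothRoadA

/-! ### v0-REG: the (A2) junction as a SECOND, already-discharged-in-HOME stub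
This variant imports TREE modules only (★ p769385 ed. 1 for the carriers), so it elaborates on the farm TODAY and can be registered by
`ledger crux write` tonight.  The junction ED. 2 ⧺ (A2) — GREEN in HOME (B-p05 (g19) rf 218359069d8935f4 ⧺ eae6db501ca1a7e8, trio) but not
yet in the tree — appears as `stub_junctionA2`, whose statement is LETTER-IDENTICAL to (A2)'s head
`SiegelFineModuliScheme.smooth_of_forall_smallExtension_ne_top_exists_polarizedLift`; when ED. 2 → (A2) land, v1 of this file replaces
`stub_junctionA2 …` by that name (one token) and the registered sorries drop 2 → 1.  `sorry` census: {stub_junctionA2, stub_polarizedLift}. -/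

/-- (ED. 3P: UNUSED from this edition on — `stub_F11` goes through the PRINCIPAL junction ★ (A2♯) p795680; kept for the record, B-p05 (g19) may drop it.)
**stub (JUNCTION, ★ (A2) p794350): Artinian lifting of the LEVEL-FREE polarised abelian scheme along genuine
small extensions ⟹ the fine moduli scheme is smooth over `ℚ`.**  Letter-identical to (A2)
`SiegelFineModuliScheme.smooth_of_forall_smallExtension_ne_top_exists_polarizedLift` (B-p05 (g19) rf v3 eae6db501ca1a7e8, GREEN by paste over
ED. 2 218359069d8935f4 of ★ p769385, axioms trio): [EGAIV4] (17.14.2) through «fine moduli» ([MumfordFogartyKirwan1994] Thm. 7.9;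
[Lan2013PELCompactifications] §2.2.1) + level structure / type / symplectic liftability / second normalisation of the lift for free
([SGA1] I 5.6; ★ relation-form transfers; ★ `DualPair.normalize`).  Size: 0 (bytes exist); why it might fail: it cannot — kernel-checked.
[cite: EGAIV4, Prop. (17.14.2) p. 98] [cite: MumfordFogartyKirwan1994, Ch. 7 §3 Theorem 7.9 (p. 139)] [cite: Lan2013PELCompactifications, §2.2.1 (p. 130)] -/
theorem stub_junctionA2 {g N : ℕ} {δ : Fin g → ℕ} (𝓜 : SiegelFineModuliScheme g N δ) [LocallyOfFiniteType 𝓜.M.hom] (hN : N ≠ 0)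
    (H : ∀ (A : Type) [CommRing A] [Algebra ℚ A] [IsArtinianRing A] [IsLocalRing A] (J : Ideal A),
      J ≠ ⊤ → IsLocalRing.maximalIdeal A * J = ⊥ →
      ∀ P₀ : PolarizedAbelianSchemeWithLevel g N δ (Spec (.of (A ⧸ J))),
        ∃ (X : AbelianSchemeOver (Spec (.of A))) (_ : X.IsOfRelDim g) (D : X.DualPair) (pol : X.Polarization D)
          (G : P₀.A.X.left ⟶ X.X.left) (Ĝ : P₀.D.hat.X.left ⟶ D.hat.X.left)
          (hG : P₀.A.IsBaseChangeVia X (Spec.map (CommRingCat.ofHom (Ideal.Quotient.mk J))) G)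
          (hĜ : P₀.D.hat.IsBaseChangeVia D.hat (Spec.map (CommRingCat.ofHom (Ideal.Quotient.mk J))) Ĝ),
          Nonempty ((Scheme.Modules.pullback
            (pullback.map P₀.A.X.hom P₀.D.hat.X.hom X.X.hom D.hat.X.hom G Ĝ
              (Spec.map (CommRingCat.ofHom (Ideal.Quotient.mk J))) hG.fst.symm hĜ.fst.symm)).obj D.P ≅ P₀.D.P) ∧
          P₀.pol.lam.left ≫ Ĝ = G ≫ pol.lam.left) :
    Smooth 𝓜.M.hom :=
  𝓜.smooth_of_forall_smallExtension_ne_top_exists_polarizedLift hN H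

/-- **stub α1-P (ED. 3P; cut α, PRINCIPAL letter) — PROVED BY NAME (ED. 5) over `Theorems/F11SmoothRoadAStubF11` (`stub_liftWithLineBundle_holds`):
the PAIR `(A₀, L^Δ(λ₀))` lifts along a principal small extension of Artinian local
`ℚ`-algebras.**  For `A` Artinian local with `ℚ ⊆ A`, `t ∈ 𝔪_A`, `t ≠ 0`, `𝔪_A·(t) = 0` (so `J := (t) ≠ ⊤`), an abelian scheme `A₀` of relative dimension `g` over `Spec (A⧸(t))` with a
dual pair `D₀` and a polarisation `λ₀` with graph `Gr₀ = (1, λ₀)`: there are an abelian scheme `X` of relative dimension `g` over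
`Spec A`, a base-change square `G : A₀ → X` of group schemes over `Spec (A⧸J) → Spec A`, and a rank-one module `L` on `X`,
rigidified along `ε_X` (`ε_X^*[L] = 1`), with `G^*L ≅ L^Δ(λ₀) = Gr₀^*𝒫₀`.  Print: [Oort1971] §2.2–2.4 (deformations of `(X₀, L₀)` are
unobstructed in characteristic `0` when `L₀` is non-degenerate); [MumfordFogartyKirwan1994] App. 7A (p. 235); [Lan2013PELCompactifications]
Prop. 2.2.2.3; [Schlessinger1968] (1.2)–(1.3) (principal small extensions suffice).  = the head `stub_liftWithLineBundle_holds` of the grandchild line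
`Cruxes/HDel/Lines/F11LiftWithLineBundle.lean` v0.2P VERBATIM (F0P1b-plan (g0) LETTERS e16e5f66).  Size: L–XL (its sub-line is the card's §3).
[cite: MumfordFogartyKirwan1994, App. 7A (pp. 234–235)] [cite: Schlessinger1968, (1.2)–(1.3) (p. 209)]
[cite: Lan2013PELCompactifications, §2.2.1 (p. 130)] -/
theorem stub_liftWithLineBundle (g : ℕ) :
    ∀ (A : Type) [CommRing A] [Algebra ℚ A] [IsArtinianRing A] [IsLocalRing A] (t : A),
      t ≠ 0 → t ∈ maximalIdeal A → maximalIdeal A * Ideal.span {t} = ⊥ →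
      ∀ (A₀ : AbelianSchemeOver (Spec (.of (A ⧸ Ideal.span {t})))) (_ : A₀.IsOfRelDim g) (D₀ : A₀.DualPair) (pol₀ : A₀.Polarization D₀)
        (Gr₀ : A₀.X.left ⟶ A₀.prodLeft D₀.hat) (_ : Gr₀ ≫ pullback.fst A₀.X.hom D₀.hat.X.hom = 𝟙 _)
        (_ : Gr₀ ≫ pullback.snd A₀.X.hom D₀.hat.X.hom = pol₀.lam.left),
        ∃ (X : AbelianSchemeOver (Spec (.of A))) (_ : X.IsOfRelDim g) (G : A₀.X.left ⟶ X.X.left)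
          (_ : A₀.IsBaseChangeVia X (Spec.map (CommRingCat.ofHom (Ideal.Quotient.mk (Ideal.span {t})))) G)
          (L : X.left.Modules) (hL : HasRank L 1)
          (_ : CechPic.pullback X.unitSection (detClass (HasRank.isFiniteLocallyFree' hL)) = 1),
          Nonempty ((Scheme.Modules.pullback G).obj L ≅ (Scheme.Modules.pullback Gr₀).obj D₀.P) :=
  -- (ED. 5) α1-P BY NAME: G0 ⊕ MONO-G1 ⊕ MONO-G2 (B-p05 (g20) `Theorems/F11SmoothRoadAStubF11`)
  stub_liftWithLineBundle_holds g

/-- **stub F-3 (Artin slice) — PROVED BY NAME (ED. 4) over ★ p797885 `Theorems/F3DualAbelianSchemeStubF3` (`stub_dualPairOfLift_holds`):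
an abelian scheme over an Artinian local `ℚ`-algebra has a dual pair** — the `stub_F3` letter of the
P1 line `F3DualAbelianScheme` at the base `S = Spec A` ([MumfordFogartyKirwan1994] Ch. 6 §1 Cor. 6.8: `Pic^τ(X/S) = X̂` exists and is
an abelian scheme, with its Poincaré sheaf).  Size: = F-3 (XL as a programme; S as a consumer of F-3's head).
[cite: MumfordFogartyKirwan1994, Ch. 6 §1 Cor. 6.8 (p. 118)] -/
theorem stub_dualPairOfLift (g : ℕ) :
    ∀ (A : Type) [CommRing A] [Algebra ℚ A] [IsArtinianRing A] [IsLocalRing A] (X : AbelianSchemeOver (Spec (.of A))),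
      X.IsOfRelDim g → IsProjective X.X.hom → Nonempty X.DualPair :=
  -- (ED. 4) α2′ BY NAME: the F-3 head at the Artin base, ★ p797885 T4 (F0P1c-p06 (g2))
  stub_dualPairOfLift_holds g

/-- **αP (junction; ★ p792151 + p792245, B-p18 (g21)): the lift is PROJECTIVE — now a THEOREM by name** (`AbelianSchemeOver.isProjective_of_isBaseChangeVia_of_iso_pullback_LDelta`).  If a rank-one `L` on the lift `X → Spec A` restricts along the
base-change square `G : A₀ → X` to the Mumford bundle `L^Δ(λ₀) = (1, λ₀)^*𝒫₀` of a polarisation `λ₀`, then `X → Spec A` is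
projective: `L^Δ(λ₀)` is relatively ample (`λ₀` a polarisation: [MumfordFogartyKirwan1994] Ch. 6 §2 Def. 6.3 + Prop. 6.10, on every
geometric fibre `L^Δ(λ₀)_s̄ ≡ 2Θ` ample), and for a PROPER morphism ampleness of `L` on the fibre over the closed point of the
Artinian base spreads to `L` ([EGAIII1] Thm. (4.7.1); [Hartshorne1977] III Ex. 5.7), so `X ↪ ℙ(Γ(X, L^{⊗n}))` is a closed `Spec A`-
immersion ([EGAII] (4.4.2)/(5.5.3)).  B-typ02 (g17) 20:36:44Z finding: WITHOUT it the F-3 head (★ road (Q), `IsProjective` binder of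
`stub_F3`/`stub_F3M` ed. 1.1) does not serve α2, and abelian schemes over `k[ε]` need not be projective.  Size: S–M.
[cite: MumfordFogartyKirwan1994, Ch. 6 §2 Definition 6.3 (p. 120) and Proposition 6.10 (p. 121)] [cite: Hartshorne1977, III Ex. 5.7] -/
theorem stub_projectiveOfLift (g : ℕ) :
    ∀ (A : Type) [CommRing A] [Algebra ℚ A] [IsArtinianRing A] [IsLocalRing A] (J : Ideal A),
      J ≠ ⊤ → maximalIdeal A * J = ⊥ →
      ∀ (A₀ : AbelianSchemeOver (Spec (.of (A ⧸ J)))) (_ : A₀.IsOfRelDim g) (D₀ : A₀.DualPair) (pol₀ : A₀.Polarization D₀)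
        (Gr₀ : A₀.X.left ⟶ A₀.prodLeft D₀.hat) (_ : Gr₀ ≫ pullback.fst A₀.X.hom D₀.hat.X.hom = 𝟙 _)
        (_ : Gr₀ ≫ pullback.snd A₀.X.hom D₀.hat.X.hom = pol₀.lam.left)
        (X : AbelianSchemeOver (Spec (.of A))) (G : A₀.X.left ⟶ X.X.left)
        (_ : A₀.IsBaseChangeVia X (Spec.map (CommRingCat.ofHom (Ideal.Quotient.mk J))) G)
        (L : X.left.Modules) (_ : HasRank L 1),
        Nonempty ((Scheme.Modules.pullback G).obj L ≅ (Scheme.Modules.pullback Gr₀).obj D₀.P) → IsProjective X.X.hom := by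
  intro A _ _ _ _ J hJtop _ A₀ _ D₀ pol₀ Gr₀ hGr₁ hGr₂ X G hG L hL hLΔ
  exact AbelianSchemeOver.isProjective_of_isBaseChangeVia_of_iso_pullback_LDelta J hJtop A₀ D₀ pol₀ Gr₀ hGr₁ hGr₂ X G hG L hL hLΔ

/-- `2 ≠ 0` in the residue fields of a scheme over a field of characteristic `0`. [folklore] -/
private theorem two_ne_zero_residueField {K : Type} [Field K] [CharZero K] {S : Scheme.{0}} (f : S ⟶ Spec (.of K)) (s : S) :
    (2 : S.residueField s) ≠ 0 := by
  let φ : K →+* S.residueField s := (Spec.preimage (S.fromSpecResidueField s ≫ f)).hom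
  have h : φ 2 = 2 := map_ofNat φ 2
  rw [← h]
  exact (map_ne_zero φ).mpr two_ne_zero

/-- `Spec` of an Artinian local ring is one point, hence preconnected. [folklore] -/
private theorem preconnectedSpace_spec_of_isArtinian_isLocal (A : Type) [CommRing A] [IsArtinianRing A] [IsLocalRing A] :
    PreconnectedSpace (Spec (.of A) : Scheme.{0}) := by
  haveI : Subsingleton (Spec (.of A) : Scheme.{0}) := ⟨fun p q => PrimeSpectrum.ext
    ((IsLocalRing.eq_maximalIdeal (IsArtinianRing.isMaximal_of_isPrime (p : PrimeSpectrum A).asIdeal)).trans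
      (IsLocalRing.eq_maximalIdeal (IsArtinianRing.isMaximal_of_isPrime (q : PrimeSpectrum A).asIdeal)).symm)⟩
  exact ⟨Set.subsingleton_univ.isPreconnected⟩

/-- **`stub_polarizedLift` IS A THEOREM of α1-P + the F-3 Artin slice** (cut α assembled: ★ (7)
`exists_polarizedLift_of_lineBundle_lift` = α2 (★ dual transport) ⊕ α3 (`Λ(L) = [2] ≫ λ`)).  ED. 3P: stated along a PRINCIPAL small
extension `A ↠ A⧸(t)` (`t ≠ 0`, `t ∈ 𝔪_A`, `𝔪_A·(t) = 0`) — the shape ★ (A2♯) consumes; `(t) ≠ ⊤` is derived inside.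
[cite: MumfordFogartyKirwan1994, Ch. 6 §2 Proposition 6.10–6.11 (pp. 121–122) and App. 7A (pp. 234–235)] -/
theorem stub_polarizedLift (g : ℕ) :
    ∀ (A : Type) [CommRing A] [Algebra ℚ A] [IsArtinianRing A] [IsLocalRing A] (t : A),
      t ≠ 0 → t ∈ maximalIdeal A → maximalIdeal A * Ideal.span {t} = ⊥ →
      ∀ (A₀ : AbelianSchemeOver (Spec (.of (A ⧸ Ideal.span {t})))) (_ : A₀.IsOfRelDim g) (D₀ : A₀.DualPair)
        (_ : Nonempty ((Scheme.Modules.pullback (AbelianSchemeOver.DualPair.unitHatSlice D₀)).obj D₀.P ≅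
          SheafOfModules.unit _))
        (pol₀ : A₀.Polarization D₀),
        ∃ (X : AbelianSchemeOver (Spec (.of A))) (_ : X.IsOfRelDim g) (D : X.DualPair) (pol : X.Polarization D)
          (G : A₀.X.left ⟶ X.X.left) (Ĝ : D₀.hat.X.left ⟶ D.hat.X.left)
          (hG : A₀.IsBaseChangeVia X (Spec.map (CommRingCat.ofHom (Ideal.Quotient.mk (Ideal.span {t})))) G)
          (hĜ : D₀.hat.IsBaseChangeVia D.hat (Spec.map (CommRingCat.ofHom (Ideal.Quotient.mk (Ideal.span {t})))) Ĝ),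
          Nonempty ((Scheme.Modules.pullback
            (pullback.map A₀.X.hom D₀.hat.X.hom X.X.hom D.hat.X.hom G Ĝ
              (Spec.map (CommRingCat.ofHom (Ideal.Quotient.mk (Ideal.span {t})))) hG.fst.symm hĜ.fst.symm)).obj D.P ≅ D₀.P) ∧
          pol₀.lam.left ≫ Ĝ = G ≫ pol.lam.left := by
  intro A _ _ _ _ t ht0 htm hJ A₀ hA₀ D₀ hD₀ pol₀
  -- the principal ideal `(t)` is proper since `t ∈ 𝔪_A` (as ★ (A2♯) p795680 derives it)
  have hJtop : Ideal.span {t} ≠ ⊤ := fun h =>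
    (IsLocalRing.mem_maximalIdeal _).mp htm (Ideal.span_singleton_eq_top.mp h)
  haveI := pol₀.isMonHom
  -- the graph of `λ₀`
  let Gr₀ : A₀.X.left ⟶ A₀.prodLeft D₀.hat :=
    pullback.lift (𝟙 _) pol₀.lam.left (by rw [Category.id_comp]; exact (Over.w pol₀.lam).symm)
  have hGr₁ : Gr₀ ≫ pullback.fst A₀.X.hom D₀.hat.X.hom = 𝟙 _ := pullback.lift_fst _ _ _
  have hGr₂ : Gr₀ ≫ pullback.snd A₀.X.hom D₀.hat.X.hom = pol₀.lam.left := pullback.lift_snd _ _ _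
  -- α1: lift the pair
  obtain ⟨X, hX, G, hG, L, hL, hε, hLΔ⟩ := stub_liftWithLineBundle g A t ht0 htm hJ A₀ hA₀ D₀ pol₀ Gr₀ hGr₁ hGr₂
  -- the lift is projective (junction αP), so F-3 at the Artin base gives some dual pair of it (α2)
  have hXproj : IsProjective X.X.hom := stub_projectiveOfLift g A (Ideal.span {t}) hJtop hJ A₀ hA₀ D₀ pol₀ Gr₀ hGr₁ hGr₂ X G hG L hL hLΔ
  obtain ⟨DX⟩ := stub_dualPairOfLift g A X hX hXproj
  -- the bases: connected, locally Noetherian, non-empty, `2` invertible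
  haveI : Nontrivial (A ⧸ Ideal.span {t}) := Ideal.Quotient.nontrivial_iff.mpr hJtop
  haveI : IsLocalRing (A ⧸ Ideal.span {t}) := IsLocalRing.of_surjective' (Ideal.Quotient.mk (Ideal.span {t})) Ideal.Quotient.mk_surjective
  haveI : IsClosedImmersion (Spec.map (CommRingCat.ofHom (Ideal.Quotient.mk (Ideal.span {t})))) :=
    IsClosedImmersion.spec_of_surjective _ Ideal.Quotient.mk_surjective
  haveI : Surjective (Spec.map (CommRingCat.ofHom (Ideal.Quotient.mk (Ideal.span {t})))) := ⟨by
    intro y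
    obtain ⟨M, hM⟩ := Ideal.exists_maximal (A ⧸ Ideal.span {t})
    refine ⟨(⟨M, hM.isPrime⟩ : PrimeSpectrum (A ⧸ Ideal.span {t})), PrimeSpectrum.ext ?_⟩
    rw [IsLocalRing.eq_maximalIdeal (IsArtinianRing.isMaximal_of_isPrime y.asIdeal)]
    exact IsLocalRing.eq_maximalIdeal (IsArtinianRing.isMaximal_of_isPrime _)⟩
  haveI : PreconnectedSpace (Spec (.of A) : Scheme.{0}) := preconnectedSpace_spec_of_isArtinian_isLocal A
  haveI : PreconnectedSpace (Spec (.of (A ⧸ Ideal.span {t})) : Scheme.{0}) := preconnectedSpace_spec_of_isArtinian_isLocal (A ⧸ Ideal.span {t})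
  haveI : Nonempty (Spec (.of (A ⧸ Ideal.span {t})) : Scheme.{0}) :=
    ⟨(⟨maximalIdeal (A ⧸ Ideal.span {t}), (maximalIdeal.isMaximal (A ⧸ Ideal.span {t})).isPrime⟩ : PrimeSpectrum (A ⧸ Ideal.span {t}))⟩
  have h2 : ∀ s : (Spec (.of A) : Scheme.{0}), (2 : (Spec (.of A)).residueField s) ≠ 0 :=
    two_ne_zero_residueField (Spec.map (CommRingCat.ofHom (algebraMap ℚ A)))
  have h2₀ : ∀ s : (Spec (.of (A ⧸ Ideal.span {t})) : Scheme.{0}), (2 : (Spec (.of (A ⧸ Ideal.span {t}))).residueField s) ≠ 0 :=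
    two_ne_zero_residueField (Spec.map (CommRingCat.ofHom (algebraMap ℚ (A ⧸ Ideal.span {t}))))
  -- α2 ⊕ α3
  obtain ⟨D, pol, Ĝ, hĜ, hP, hlam⟩ := AbelianSchemeOver.exists_polarizedLift_of_lineBundle_lift (X := X)
    (i := Spec.map (CommRingCat.ofHom (Ideal.Quotient.mk (Ideal.span {t})))) h2 h2₀ hG D₀ hD₀ pol₀ Gr₀ hGr₁ hGr₂ DX hL hε hLΔ
  exact ⟨X, hX, D, pol, G, Ĝ, hG, hĜ, hP, hlam⟩

/-- **F-11 by ROAD A — the composition (kernel-checked; ED. 3P: through ★ (A2♯) `smooth_of_forall_principalSmallExtension_exists_polarizedLift`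
over `stub_polarizedLift` at principal small extensions; `sorry`s in its cone = α1-P + α2′ only):** the `hF11` letter
VERBATIM — for `0 < g`, `δ` a polarisation type, `3 ≤ N`, every fine moduli scheme `𝓜` of the Siegel functor that is locally of
finite type over `ℚ` is SMOOTH over `ℚ` — from `stub_polarizedLift` (principal small extensions) through ★ (A2♯)
`SiegelFineModuliScheme.smooth_of_forall_principalSmallExtension_exists_polarizedLift` (p795680; EGA IV 17.14.2 via «fine moduli» + level /
clauses / normalisation for free; ED. 2‴ went through the general-`J` (A2) `stub_junctionA2`), instantiated at the level-free part `(P₀.A, P₀.relDim, P₀.D, P₀.hatNormalised, P₀.pol)` of each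
test triple. [cite: Lan2013PELCompactifications, Thm. 1.4.1.11 (p. 91) and §2.2.1 (p. 130)]
[cite: MumfordFogartyKirwan1994, Ch. 7 §3 Theorem 7.9 (p. 139) and App. 7A (pp. 234–235)] [cite: EGAIV4, Prop. (17.14.2) p. 98] -/
theorem stub_F11 : ∀ (g N : ℕ) (δ : Fin g → ℕ), 0 < g → IsPolarizationType δ → 3 ≤ N →
    ∀ 𝓜 : SiegelFineModuliScheme g N δ, LocallyOfFiniteType 𝓜.M.hom → Smooth 𝓜.M.hom := by
  intro g N δ _hg _hδ hN 𝓜 _hft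
  -- (ED. 3P) EGA IV 17.14.2 through «fine moduli» needs lifts along PRINCIPAL small extensions only: ★ (A2♯) p795680
  exact 𝓜.smooth_of_forall_principalSmallExtension_exists_polarizedLift (by omega)
    fun A _ _ _ _ _ t ht0 htm htJ P₀ => stub_polarizedLift g A t ht0 htm htJ P₀.A P₀.relDim P₀.D P₀.hatNormalised P₀.pol

end Summit.HodgeConjecture.CorCM.Cruxes.HypDel.F11SmoothRoadA

end
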